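import Summits.SmoothPoincare4.SmoothPoincare4.Theorems.SymplecticOrigamiGromovRecognitionRelEndStubPositiveHolonomyAux1
import Summits.SmoothPoincare4.SmoothPoincare4.Theorems.SymplecticOrigamiGromovRecognitionRelEndStubFlatLeavesAux

/-!
# Positive holonomy for `GromovRecognitionRelEnd` — flat charts of a retraction onto `H∞`
(stub `stub_positiveHolonomy` of line `cross-cap-laurent`, crux `SymplecticOrigami.GromovRecognitionRelEnd`,
item stmt-SmoothPoincare4-11009; second auxiliary file)

A map `λ : X → X` of the wedge cap with values in the sphere `H∞ = ηH (ℂ × 0) ∪ {ηC 0}` factors,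
near every point `y₀`, through one of the two cap charts of `H∞`: there are an injective holomorphic
local diffeomorphism `η : ℝ⁴ ⊇ D → X` (`η = ηH` if `λ y₀` is affine, `η = ηC` if `λ y₀ = ηC 0` is
the corner, using the gluing `ηC (u, 0) = ηH (1/u, 0)` beyond a compact piece of the axis) and an
open `N ∋ y₀` with `λ y = η p`, `p ∈ D ∩ (ℂ × 0)` for `y ∈ N` (`exists_flatChart`).  In such a
**flat chart** `λ = η ∘ ℓ` with `ℓ = η⁻¹ ∘ λ` smooth and valued in the axis plane, so
`dλ = dη ∘ dℓ` with `dℓ` valued in `{p₂ = p₃ = 0}` (`invChart_spec`, `contMDiffAt_invChart`,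
`mfderiv_eq_comp_invChart`, `mfderiv_invChart_plane`, `mfderiv_eq_zero_iff_invChart`,
`hol_at_invChart`).  Also: cap charts may be precomposed with a linear automorphism of `ℝ⁴`
commuting with `I4` (`isLocalDiffeomorphOn_comp_equiv`, `hol_comp_equiv`), which turns the charts
of `V∞` into charts of the same shape as those of `H∞` (coordinate swap).
-/

noncomputable section

-- the registered namespace `Summit.SmoothPoincare4.SmoothPoincare4.Theorems…` repeats a component
set_option linter.dupNamespace false

open scoped Manifold ContDiff Topology
open Set Function Filter

namespace Summit.SmoothPoincare4.SmoothPoincare4.Theorems.GromovRecognitionRelEnd.CrossCapLaurent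

namespace PosHolonomy

open CapModel FlatLeaves

variable {X : Type*} [TopologicalSpace X] [ChartedSpace (EuclideanSpace ℝ (Fin 4)) X]

/-! ## Precomposing a cap chart with a linear automorphism of `ℝ⁴` -/

section Comp

variable {η : EuclideanSpace ℝ (Fin 4) → X} {D : Set (EuclideanSpace ℝ (Fin 4))}
  (S : EuclideanSpace ℝ (Fin 4) ≃L[ℝ] EuclideanSpace ℝ (Fin 4))

/-- A local diffeomorphism on `D` precomposed with a linear automorphism `S` is a local
diffeomorphism on `S ⁻¹' D`. [folklore] -/
theorem isLocalDiffeomorphOn_comp_equiv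
    (hη : IsLocalDiffeomorphOn 𝓘(ℝ, EuclideanSpace ℝ (Fin 4)) (𝓡 4) ∞ η D) :
    IsLocalDiffeomorphOn 𝓘(ℝ, EuclideanSpace ℝ (Fin 4)) (𝓡 4) ∞ (η ∘ S) (S ⁻¹' D) := by
  rintro ⟨p, hp⟩
  exact (S.toDiffeomorph.isLocalDiffeomorph p).comp (𝓡 4) X (hη ⟨S p, hp⟩)

omit [TopologicalSpace X] [ChartedSpace (EuclideanSpace ℝ (Fin 4)) X] in
/-- Injectivity on `D` passes to `η ∘ S` on `S ⁻¹' D`. [folklore] -/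
theorem injOn_comp_equiv (hinj : InjOn η D) : InjOn (η ∘ S) (S ⁻¹' D) :=
  hinj.comp S.injective.injOn (mapsTo_preimage S D)

omit [TopologicalSpace X] [ChartedSpace (EuclideanSpace ℝ (Fin 4)) X] in
/-- The preimage of an open domain is open. [folklore] -/
theorem isOpen_preimage_equiv (hD : IsOpen D) : IsOpen (S ⁻¹' D) :=
  hD.preimage S.continuous

/-- Chain rule: `d(η ∘ S)_p q = dη_{S p} (S q)`. [folklore] -/
theorem mfderiv_comp_equiv {p : EuclideanSpace ℝ (Fin 4)}
    (hη : MDifferentiableAt 𝓘(ℝ, EuclideanSpace ℝ (Fin 4)) (𝓡 4) η (S p))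
    (q : EuclideanSpace ℝ (Fin 4)) :
    mfderiv 𝓘(ℝ, EuclideanSpace ℝ (Fin 4)) (𝓡 4) (η ∘ S) p q =
      mfderiv 𝓘(ℝ, EuclideanSpace ℝ (Fin 4)) (𝓡 4) η (S p) (S q) := by
  have h := (hη.hasMFDerivAt.comp p S.hasMFDerivAt).mfderiv
  have h' := congrArg
    (fun L : EuclideanSpace ℝ (Fin 4) →L[ℝ] EuclideanSpace ℝ (Fin 4) => L q) h
  exact h'

/-- **Holomorphy passes to `η ∘ S`** when `S` commutes with `I4`. [folklore] -/
theorem hol_comp_equiv {JX : ∀ y : X, TangentSpace (𝓡 4) y →L[ℝ] TangentSpace (𝓡 4) y}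
    (hη : IsLocalDiffeomorphOn 𝓘(ℝ, EuclideanSpace ℝ (Fin 4)) (𝓡 4) ∞ η D)
    (hhol : ∀ p ∈ D, ∀ q : EuclideanSpace ℝ (Fin 4),
      JX (η p) (mfderiv 𝓘(ℝ, EuclideanSpace ℝ (Fin 4)) (𝓡 4) η p q) =
        mfderiv 𝓘(ℝ, EuclideanSpace ℝ (Fin 4)) (𝓡 4) η p (I4 q))
    (hSI : ∀ q, S (I4 q) = I4 (S q)) :
    ∀ p ∈ S ⁻¹' D, ∀ q : EuclideanSpace ℝ (Fin 4),
      JX ((η ∘ S) p) (mfderiv 𝓘(ℝ, EuclideanSpace ℝ (Fin 4)) (𝓡 4) (η ∘ S) p q) =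
        mfderiv 𝓘(ℝ, EuclideanSpace ℝ (Fin 4)) (𝓡 4) (η ∘ S) p (I4 q) := by
  intro p hp q
  have hd : MDifferentiableAt 𝓘(ℝ, EuclideanSpace ℝ (Fin 4)) (𝓡 4) η (S p) :=
    (contMDiffAt_of_mem hη hp).mdifferentiableAt (by simp)
  rw [mfderiv_comp_equiv S hd, mfderiv_comp_equiv S hd, hSI]
  exact hhol (S p) hp (S q)

end Comp

/-! ## Existence of flat charts -/

/-- **Flat charts of a map into `H∞`.** Let `λ : X → X` be continuous with values in
`H∞ = ηA {p₂ = p₃ = 0} ∪ {ηK 0}`, where `ηA` (affine chart, defined on an open `DA` containing the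
axis plane) and `ηK` (corner chart, on an open `DK ∋ 0`) are injective holomorphic local
diffeomorphisms, the affine axis misses the corner `ηK 0`, and beyond the compact piece
`{|z₁|² ≤ ρ}` of the axis the affine chart is re-read in the corner chart on its axis
(`ηA p = ηK p'`).  Then near every `y₀`, `λ` factors through ONE of the two charts along the axis
plane: `λ y = η p`, `p ∈ D`, `p₂ = p₃ = 0`. [folklore] -/
theorem exists_flatChart [T2Space X]
    {JX : ∀ y : X, TangentSpace (𝓡 4) y →L[ℝ] TangentSpace (𝓡 4) y} {lam : X → X}
    (hlam : Continuous lam) {ηA ηK : EuclideanSpace ℝ (Fin 4) → X}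
    {DA DK : Set (EuclideanSpace ℝ (Fin 4))} (hDA : IsOpen DA)
    (hA : IsLocalDiffeomorphOn 𝓘(ℝ, EuclideanSpace ℝ (Fin 4)) (𝓡 4) ∞ ηA DA) (hAi : InjOn ηA DA)
    (hAhol : ∀ p ∈ DA, ∀ q : EuclideanSpace ℝ (Fin 4),
      JX (ηA p) (mfderiv 𝓘(ℝ, EuclideanSpace ℝ (Fin 4)) (𝓡 4) ηA p q) =
        mfderiv 𝓘(ℝ, EuclideanSpace ℝ (Fin 4)) (𝓡 4) ηA p (I4 q))
    (hDK : IsOpen DK) (hK : IsLocalDiffeomorphOn 𝓘(ℝ, EuclideanSpace ℝ (Fin 4)) (𝓡 4) ∞ ηK DK)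
    (hKi : InjOn ηK DK)
    (hKhol : ∀ p ∈ DK, ∀ q : EuclideanSpace ℝ (Fin 4),
      JX (ηK p) (mfderiv 𝓘(ℝ, EuclideanSpace ℝ (Fin 4)) (𝓡 4) ηK p q) =
        mfderiv 𝓘(ℝ, EuclideanSpace ℝ (Fin 4)) (𝓡 4) ηK p (I4 q))
    (hin : ∀ y, (∃ p : EuclideanSpace ℝ (Fin 4), p 2 = 0 ∧ p 3 = 0 ∧ ηA p = lam y) ∨ lam y = ηK 0)
    (haxA : ∀ p : EuclideanSpace ℝ (Fin 4), p 2 = 0 → p 3 = 0 → p ∈ DA)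
    (h0K : (0 : EuclideanSpace ℝ (Fin 4)) ∈ DK)
    (hdisj : ∀ p : EuclideanSpace ℝ (Fin 4), p 2 = 0 → p 3 = 0 → ηA p ≠ ηK 0) {ρ : ℝ}
    (hglue : ∀ p : EuclideanSpace ℝ (Fin 4), p 2 = 0 → p 3 = 0 → ρ < r1 p →
      ∃ p' ∈ DK, p' 2 = 0 ∧ p' 3 = 0 ∧ ηK p' = ηA p)
    (y₀ : X) :
    ∃ (η : EuclideanSpace ℝ (Fin 4) → X) (D : Set (EuclideanSpace ℝ (Fin 4))) (N : Set X),
      IsOpen D ∧ IsLocalDiffeomorphOn 𝓘(ℝ, EuclideanSpace ℝ (Fin 4)) (𝓡 4) ∞ η D ∧ InjOn η D ∧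
      (∀ p ∈ D, ∀ q : EuclideanSpace ℝ (Fin 4),
        JX (η p) (mfderiv 𝓘(ℝ, EuclideanSpace ℝ (Fin 4)) (𝓡 4) η p q) =
          mfderiv 𝓘(ℝ, EuclideanSpace ℝ (Fin 4)) (𝓡 4) η p (I4 q)) ∧
      IsOpen N ∧ y₀ ∈ N ∧
      ∀ y ∈ N, ∃ p ∈ D, p 2 = 0 ∧ p 3 = 0 ∧ η p = lam y := by
  by_cases hy₀ : lam y₀ = ηK 0
  · -- the corner chart; first remove the compact affine piece `ηA {axis, |z₁|² ≤ ρ}`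
    set C : Set (EuclideanSpace ℝ (Fin 4)) := {p | p 2 = 0 ∧ p 3 = 0 ∧ r1 p ≤ ρ} with hC
    have hCc : IsCompact C := by
      have hcl : IsClosed C := by
        refine (isClosed_eq (contDiff_coord 2).continuous continuous_const).inter
          ((isClosed_eq (contDiff_coord 3).continuous continuous_const).inter
            (isClosed_le continuous_r1 continuous_const))
      refine (isCompact_closedBall (0 : EuclideanSpace ℝ (Fin 4)) (Real.sqrt ρ)).of_isClosed_subset
        hcl ?_
      rintro p ⟨h2, h3, hr⟩
      have h0 : r2 p = 0 := by rw [r2_def, h2, h3]; ring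
      have hρ : 0 ≤ ρ := (r1_nonneg p).trans hr
      rw [Metric.mem_closedBall, dist_zero_right, Real.le_sqrt (norm_nonneg _) hρ,
        norm_sq_eq_r1_add_r2]
      linarith
    have hCA : C ⊆ DA := fun p hp => haxA p hp.1 hp.2.1
    have hF : IsClosed (ηA '' C) :=
      (hCc.image_of_continuousOn (hA.contMDiffOn.continuousOn.mono hCA)).isClosed
    have hF0 : ηK 0 ∉ ηA '' C := by
      rintro ⟨p, hp, he⟩
      exact hdisj p hp.1 hp.2.1 he
    refine ⟨ηK, DK, lam ⁻¹' (ηA '' C)ᶜ, hDK, hK, hKi, hKhol, hF.isOpen_compl.preimage hlam, ?_, ?_⟩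
    · show lam y₀ ∈ (ηA '' C)ᶜ
      rw [hy₀]; exact hF0
    · intro y hy
      rcases hin y with ⟨p, h2, h3, he⟩ | he
      · have hpC : p ∉ C := fun hpC => hy ⟨p, hpC, he⟩
        have hρ : ρ < r1 p := by
          by_contra hle
          exact hpC ⟨h2, h3, not_lt.1 hle⟩
        obtain ⟨p', hp', h2', h3', he'⟩ := hglue p h2 h3 hρ
        exact ⟨p', hp', h2', h3', he'.trans he⟩
      · exact ⟨0, h0K, rfl, rfl, he.symm⟩
  · -- the affine chart, away from the corner
    refine ⟨ηA, DA, lam ⁻¹' {ηK 0}ᶜ, hDA, hA, hAi, hAhol, isOpen_compl_singleton.preimage hlam, hy₀,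
      ?_⟩
    intro y hy
    rcases hin y with ⟨p, h2, h3, he⟩ | he
    · exact ⟨p, haxA p h2 h3, h2, h3, he⟩
    · exact absurd he hy

/-! ## Calculus in a flat chart: `λ = η ∘ ℓ`, `ℓ = η⁻¹ ∘ λ` valued in the axis plane -/

section Chart

variable {lam : X → X} {η : EuclideanSpace ℝ (Fin 4) → X}
  {D : Set (EuclideanSpace ℝ (Fin 4))} {N : Set X}
  (hD : IsOpen D) (hη : IsLocalDiffeomorphOn 𝓘(ℝ, EuclideanSpace ℝ (Fin 4)) (𝓡 4) ∞ η D)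
  (hinj : InjOn η D)
  (hflat : ∀ y ∈ N, ∃ p ∈ D, p 2 = 0 ∧ p 3 = 0 ∧ η p = lam y)

include hinj hflat in
omit [TopologicalSpace X] [ChartedSpace (EuclideanSpace ℝ (Fin 4)) X] in
/-- In a flat chart, `ℓ = η⁻¹ ∘ λ` lands in `D` on the axis plane and `η ∘ ℓ = λ`. [folklore] -/
theorem invChart_spec {y : X} (hy : y ∈ N) :
    (invFunOn η D ∘ lam) y ∈ D ∧ (invFunOn η D ∘ lam) y 2 = 0 ∧ (invFunOn η D ∘ lam) y 3 = 0 ∧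
      η ((invFunOn η D ∘ lam) y) = lam y := by
  obtain ⟨p, hp, h2, h3, he⟩ := hflat y hy
  have h : (invFunOn η D ∘ lam) y = p := by
    show invFunOn η D (lam y) = p
    rw [← he]
    exact invFunOn_apply_of_mem hinj hp
  rw [h]
  exact ⟨hp, h2, h3, he⟩

include hD hη hinj hflat in
/-- In a flat chart, `ℓ = η⁻¹ ∘ λ` is `C^∞` (for `λ` `C^∞`). [folklore] -/
theorem contMDiffAt_invChart (hlam : ContMDiff (𝓡 4) (𝓡 4) ∞ lam) {y : X} (hy : y ∈ N) :
    ContMDiffAt (𝓡 4) 𝓘(ℝ, EuclideanSpace ℝ (Fin 4)) ∞ (invFunOn η D ∘ lam) y := by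
  obtain ⟨p, hp, -, -, he⟩ := hflat y hy
  have h1 : ContMDiffAt (𝓡 4) 𝓘(ℝ, EuclideanSpace ℝ (Fin 4)) ∞ (invFunOn η D) (lam y) := by
    rw [← he]; exact contMDiffAt_invFunOn hD hη hinj hp
  exact h1.comp y (hlam y)

include hD hη hinj hflat in
/-- **`dλ = dη ∘ dℓ`** in a flat chart (`λ = η ∘ ℓ` on the open set `N`; the three differentials
are read at the model type `ℝ⁴ →L ℝ⁴` of the tangent spaces). [folklore] -/
theorem mfderiv_eq_comp_invChart (hlam : ContMDiff (𝓡 4) (𝓡 4) ∞ lam) (hN : IsOpen N) {y : X}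
    (hy : y ∈ N) {Lam Φ L : EuclideanSpace ℝ (Fin 4) →L[ℝ] EuclideanSpace ℝ (Fin 4)}
    (hLam : Lam = mfderiv (𝓡 4) (𝓡 4) lam y)
    (hΦ : Φ = mfderiv 𝓘(ℝ, EuclideanSpace ℝ (Fin 4)) (𝓡 4) η ((invFunOn η D ∘ lam) y))
    (hL : L = mfderiv (𝓡 4) 𝓘(ℝ, EuclideanSpace ℝ (Fin 4)) (invFunOn η D ∘ lam) y) :
    Lam = Φ.comp L := by
  subst hLam hΦ hL
  have hev : lam =ᶠ[𝓝 y] (η ∘ (invFunOn η D ∘ lam)) := by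
    filter_upwards [hN.mem_nhds hy] with y' hy'
    exact (invChart_spec hinj hflat hy').2.2.2.symm
  have h1 : MDifferentiableAt 𝓘(ℝ, EuclideanSpace ℝ (Fin 4)) (𝓡 4) η ((invFunOn η D ∘ lam) y) :=
    (contMDiffAt_of_mem hη (invChart_spec hinj hflat hy).1).mdifferentiableAt (by simp)
  have h2 : MDifferentiableAt (𝓡 4) 𝓘(ℝ, EuclideanSpace ℝ (Fin 4)) (invFunOn η D ∘ lam) y :=
    (contMDiffAt_invChart hD hη hinj hflat hlam hy).mdifferentiableAt (by simp)
  have h3 := mfderiv_comp y h1 h2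
  rw [hev.mfderiv_eq]
  exact h3

include hD hη hinj hflat in
/-- **`dℓ` is valued in the axis plane** `{p₂ = p₃ = 0}` (the coordinates `ℓ₂`, `ℓ₃` vanish on the
open set `N`). [folklore] -/
theorem mfderiv_invChart_plane (hlam : ContMDiff (𝓡 4) (𝓡 4) ∞ lam) (hN : IsOpen N) {y : X}
    (hy : y ∈ N) {L : EuclideanSpace ℝ (Fin 4) →L[ℝ] EuclideanSpace ℝ (Fin 4)}
    (hL : L = mfderiv (𝓡 4) 𝓘(ℝ, EuclideanSpace ℝ (Fin 4)) (invFunOn η D ∘ lam) y)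
    (v : EuclideanSpace ℝ (Fin 4)) : L v 2 = 0 ∧ L v 3 = 0 := by
  have hℓ : MDifferentiableAt (𝓡 4) 𝓘(ℝ, EuclideanSpace ℝ (Fin 4)) (invFunOn η D ∘ lam) y :=
    (contMDiffAt_invChart hD hη hinj hflat hlam hy).mdifferentiableAt (by simp)
  have key : ∀ i : Fin 4, (∀ y' ∈ N, (invFunOn η D ∘ lam) y' i = 0) → L v i = 0 := by
    intro i hi
    have hev : (fun _ => (0 : ℝ)) =ᶠ[𝓝 y] (pr i ∘ (invFunOn η D ∘ lam)) := by
      filter_upwards [hN.mem_nhds hy] with y' hy'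
      exact (hi y' hy').symm
    have h1 : HasMFDerivAt (𝓡 4) 𝓘(ℝ, ℝ) (pr i ∘ (invFunOn η D ∘ lam)) y ((pr i).comp L) := by
      rw [hL]
      exact (pr i).hasMFDerivAt.comp y hℓ.hasMFDerivAt
    have h2 : HasMFDerivAt (𝓡 4) 𝓘(ℝ, ℝ) (pr i ∘ (invFunOn η D ∘ lam)) y
        (0 : EuclideanSpace ℝ (Fin 4) →L[ℝ] ℝ) :=
      (hasMFDerivAt_const (0 : ℝ) y).congr_of_eventuallyEq hev.symm
    exact congrArg (fun T : EuclideanSpace ℝ (Fin 4) →L[ℝ] ℝ => T v) (hasMFDerivAt_unique h1 h2)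
  exact ⟨key 2 fun y' hy' => (invChart_spec hinj hflat hy').2.1,
    key 3 fun y' hy' => (invChart_spec hinj hflat hy').2.2.1⟩

include hD hη hinj hflat in
/-- **`dλ v = 0 ↔ dℓ v = 0`** in a flat chart (`dη` is injective). [folklore] -/
theorem mfderiv_eq_zero_iff_invChart (hlam : ContMDiff (𝓡 4) (𝓡 4) ∞ lam) (hN : IsOpen N) {y : X}
    (hy : y ∈ N) {Lam L : EuclideanSpace ℝ (Fin 4) →L[ℝ] EuclideanSpace ℝ (Fin 4)}
    (hLam : Lam = mfderiv (𝓡 4) (𝓡 4) lam y)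
    (hL : L = mfderiv (𝓡 4) 𝓘(ℝ, EuclideanSpace ℝ (Fin 4)) (invFunOn η D ∘ lam) y)
    (v : EuclideanSpace ℝ (Fin 4)) : Lam v = 0 ↔ L v = 0 := by
  obtain ⟨Φ, hΦ⟩ : ∃ Φ : EuclideanSpace ℝ (Fin 4) →L[ℝ] EuclideanSpace ℝ (Fin 4),
      Φ = mfderiv 𝓘(ℝ, EuclideanSpace ℝ (Fin 4)) (𝓡 4) η ((invFunOn η D ∘ lam) y) := ⟨_, rfl⟩
  rw [mfderiv_eq_comp_invChart hD hη hinj hflat hlam hN hy hLam hΦ hL, ContinuousLinearMap.comp_apply]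
  constructor
  · intro h
    subst hΦ
    exact mfderiv_eq_zero hD hη hinj (invChart_spec hinj hflat hy).1 h
  · intro h
    rw [h, map_zero]

include hinj hflat in
/-- **Holomorphy at `ℓ y`, based at `λ y`**: `J_{λ y} (dη_{ℓ y} q) = dη_{ℓ y} (I4 q)`. [folklore] -/
theorem hol_at_invChart {JX : ∀ y : X, TangentSpace (𝓡 4) y →L[ℝ] TangentSpace (𝓡 4) y}
    (hhol : ∀ p ∈ D, ∀ q : EuclideanSpace ℝ (Fin 4),
      JX (η p) (mfderiv 𝓘(ℝ, EuclideanSpace ℝ (Fin 4)) (𝓡 4) η p q) =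
        mfderiv 𝓘(ℝ, EuclideanSpace ℝ (Fin 4)) (𝓡 4) η p (I4 q))
    {y : X} (hy : y ∈ N) {Φ Jh : EuclideanSpace ℝ (Fin 4) →L[ℝ] EuclideanSpace ℝ (Fin 4)}
    (hΦ : Φ = mfderiv 𝓘(ℝ, EuclideanSpace ℝ (Fin 4)) (𝓡 4) η ((invFunOn η D ∘ lam) y))
    (hJh : Jh = JX (lam y)) (q : EuclideanSpace ℝ (Fin 4)) : Jh (Φ q) = Φ (I4 q) := by
  subst hΦ hJh
  obtain ⟨hmem, -, -, he⟩ := invChart_spec hinj hflat hy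
  have h := hhol _ hmem q
  have key : ∀ x : X, x = η ((invFunOn η D ∘ lam) y) →
      (JX x : EuclideanSpace ℝ (Fin 4) →L[ℝ] EuclideanSpace ℝ (Fin 4))
        (mfderiv 𝓘(ℝ, EuclideanSpace ℝ (Fin 4)) (𝓡 4) η ((invFunOn η D ∘ lam) y) q) =
      mfderiv 𝓘(ℝ, EuclideanSpace ℝ (Fin 4)) (𝓡 4) η ((invFunOn η D ∘ lam) y) (I4 q) := by
    rintro x rfl
    exact h
  exact key (lam y) he.symm

end Chart

end PosHolonomy

/-- **Registered helper sub-goal `helper_positiveHolonomyChartComp`** (second auxiliary file of stub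
`stub_positiveHolonomy`): a cap chart precomposed with a linear automorphism `S` of `ℝ⁴` is again a
local diffeomorphism, on `S ⁻¹' D`. [folklore] -/
theorem helper_positiveHolonomyChartComp : ∀ (X : Type) [TopologicalSpace X]
    [ChartedSpace (EuclideanSpace ℝ (Fin 4)) X] (η : EuclideanSpace ℝ (Fin 4) → X)
    (D : Set (EuclideanSpace ℝ (Fin 4))) (S : EuclideanSpace ℝ (Fin 4) ≃L[ℝ] EuclideanSpace ℝ (Fin 4)),
    IsLocalDiffeomorphOn 𝓘(ℝ, EuclideanSpace ℝ (Fin 4)) (𝓡 4) ∞ η D →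
    IsLocalDiffeomorphOn 𝓘(ℝ, EuclideanSpace ℝ (Fin 4)) (𝓡 4) ∞ (η ∘ S) (S ⁻¹' D) :=
  fun _ _ _ _ _ S hη => PosHolonomy.isLocalDiffeomorphOn_comp_equiv S hη

end Summit.SmoothPoincare4.SmoothPoincare4.Theorems.GromovRecognitionRelEnd.CrossCapLaurent

end
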